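import Summits.CriticalPhenomena.SAWScalingLimit.Theorems.FKGToTraversalBound.Negative.DeepEndpointGap
import HarnessLib

/-!
# Vocabulary of line `gates-by-bubble-doors-by-fkg` for crux `FKGToTraversalBound` (stmt-CriticalPhenomena-1878)

Route `route-CriticalPhenomena-SAWLeftRightFKG`, crux decl
`Summit.CriticalPhenomena.SAWScalingLimit.Theses.SAWLeftRightFKG.FKGToTraversalBound`
(`LeftRightFKG → SAWTraversalBound`).  This file is the SHARED VOCABULARY of the registered skeleton
`Cruxes/FKGToTraversalBound/Lines/gates_by_bubble_doors_by_fkg.lean` (lead prover-line-stmt-CriticalPhenomena-1878-a3-0,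
2026-08-16; `ledger skeleton check`: 7 stubs `stub_criticalBubble`, `stub_gateExcision`, `stub_wideDoorSeed`,
`stub_collarAssembly`, `stub_shellIteration`, `stub_necklace`, `stub_germExcursionMean`), so that the stub proofs —
which land one file each under `Theorems/SAWLeftRightFKGFKGToTraversalBound*.lean` — state the registered
signatures against the SAME constants, and the final composition imports them (pattern of
`SAWLeftRightFKGLeftRightFKGDefs.lean` for the sibling crux).

Contents (namespace `Summit.CriticalPhenomena.SAWScalingLimit.Theorems.FKGToTraversalBound.GatesByBubbleDoorsByFKG`),
verbatim from the skeleton (which in turn copies the engine interface of the earlier registered skeleton r8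
`Lines/excursion_domination.lean` where marked):

* lattice vocabulary: `Avoid H` (chords avoiding a site set), `OneSided le S`, `JoinedOff Λ V u v`, `InBox q w v`
  (closed lattice box of side `w`), `Behind Ω δ a b T x` (every `Ω_δ`-walk from `a` and from `b` to `x` meets the
  throat `T`);
* the statements used as HYPOTHESIS NAMES of the line's stubs (definitions, not literature facts and not
  restatements of the crux): `GatedPocketBound w₀` (gate lemma, throat form), `CollarClauses` / `IsCollaredOff` /
  `WideCollaredOff` (collar structures), `SAWCollarBound` (the engine interface, r8 verbatim), `WideCollarBound w₀`
  (the seed), `ShellTight` / `ShellTightOn` / `Presentable` / `GoodShellTight` (per-shell tightness currency, r8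
  verbatim), `InducedMesh`, `DeepShellTight`, `DeepShellTightInduced`, `RoughMeshShellTight` (deep fragment),
  `GermExcursionMean` (the rate-free first-moment input).

Only definitions; no theorem, no named literature fact.  `dom`, `lrLE` are the tree's
(`Theorems.FKGToTraversalBound.Negative.DeepEndpointGap`).
-/

noncomputable section

open MeasureTheory Filter Topology Set Metric
open scoped NNReal ENNReal
open Literature.Probability.LatticeModels
open Literature.Probability.RandomPlanarGeometry
open Literature.Probability.RandomPlanarGeometry.SAW
open Summit.CriticalPhenomena.SAWScalingLimit.Theses.SAWLeftRightFKG
open Summit.CriticalPhenomena.SAWScalingLimit.Theorems.FKGToTraversalBound.Negative (dom lrLE)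

namespace Summit.CriticalPhenomena.SAWScalingLimit.Theorems.FKGToTraversalBound.GatesByBubbleDoorsByFKG

/-! ## Vocabulary (verbatim from the registered skeleton r8 `Lines/excursion_domination.lean` where marked) -/

section Vocabulary

variable {Ω : Set ℂ} {δ : ℝ} {a b : Site 2}

/-- [r8 verbatim] The chords of `Ω_δ` from `a` to `b` that AVOID the set `H` of lattice sites.
[folklore] -/
def Avoid (H : Set (Site 2)) : Set (DomainSAW Ω δ a b) :=
  {γ | ∀ v ∈ γ.walk.support, v ∉ H}

end Vocabulary

/-- [r8 verbatim] A set `S` of chords is ONE-SIDED for the relation `le` (the route's left–right order `≼`):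
it is down-closed or up-closed.
[folklore] -/
def OneSided {ι : Type*} (le : ι → ι → Prop) (S : Set ι) : Prop :=
  (∀ γ₁ γ₂, le γ₁ γ₂ → γ₂ ∈ S → γ₁ ∈ S) ∨ (∀ γ₁ γ₂, le γ₁ γ₂ → γ₁ ∈ S → γ₂ ∈ S)

/-- [r8 verbatim] `u` and `v` are joined by a nearest-neighbour lattice path all of whose sites lie in `Λ` and
off `V`.
[folklore] -/
def JoinedOff (Λ V : Finset (Site 2)) (u v : Site 2) : Prop :=
  ∃ p : (zdGraph 2).Walk u v, ∀ x ∈ p.support, x ∈ Λ ∧ x ∉ V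

/-- The closed LATTICE BOX of side `w` (in lattice units) with lower-left corner `q`:
`{v : q₀ ≤ v₀ ≤ q₀ + w, q₁ ≤ v₁ ≤ q₁ + w}` — `(w+1)²` sites, `ℓ∞`-diameter `w`.
[folklore] -/
def InBox (q : Site 2) (w : ℕ) (v : Site 2) : Prop :=
  q 0 ≤ v 0 ∧ v 0 ≤ q 0 + w ∧ q 1 ≤ v 1 ∧ v 1 ≤ q 1 + w

/-- `x` lies **behind the throat `T`** in the lattice domain `Ω_δ`, seen from the two marked sites `a, b`: every
walk of `Ω_δ = discreteDomainGraph Ω δ` from `a` to `x` AND every walk from `b` to `x` passes through a site of `T`.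
(Sites of `T` are behind `T`; a site reachable from `a` or from `b` off `T` is not; in particular a THROUGH-room —
triage W4 — is behind nothing, and `a, b ∉ T` are never behind `T`.)
[folklore] -/
def Behind (Ω : Set ℂ) (δ : ℝ) (a b : Site 2) (T : Finset (Site 2)) (x : Site 2) : Prop :=
  (∀ p : (discreteDomainGraph Ω δ).Walk a x, ∃ y ∈ p.support, y ∈ T) ∧
  (∀ p : (discreteDomainGraph Ω δ).Walk b x, ∃ y ∈ p.support, y ∈ T)

/-! ## Statements of the line

All r2-side statements quantify over the binders of `LeftRightFKG` VERBATIM: mesh `δ > 0`, a closed lattice walk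
`C`, the carrier `dom C δ = {z | wind(δ-polyline of C, z) ≠ 0}` and endpoints `a, b` lattice-adjacent to vertices
`a', b'` of `C` (`leftRightFKG_iff_PAClause : … := Iff.rfl`). -/

/-- **GATED POCKET BOUND at throat size `w₀`** (the card's lever (G), THROAT FORM = the triage repair).  There is
`η = η(w₀) > 0` such that in every r2 carrier, for every THROAT `T` — a set of sites of `Ω_δ` inside one lattice box
`Q` of side `w₀`, missing `a` and `b`, and RECONNECTIBLE: any two throat sites are joined by an `Ω_δ`-walk inside `Q`
through throat-or-behind sites — the critical chord avoids everything behind `T` outside the box `Q` with probability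
`≥ η`:  `η · Z(a,b) ≤ Z{γ : every behind-site γ visits lies in Q}`.  Uniform in the carrier (hence in any presented
past), the mesh and the ROOM behind the throat, which is arbitrary.
PROOF CHART (given `CriticalBubbleBound`; STUB 2): for a chord `γ` that visits `T`, let `s`/`u` be its first/last visit
to `T`; `γ[0,s)` and `γ(u,1]` consist of sites joined to `a` resp. `b` off `T`, hence NOT behind; map
`γ ↦ γ* := γ[0,s] · p · γ[u,1]` with `p` a path inside `Q ∩ (T ∪ Behind)` from `γ(s)` to `γ(u)` (reconnection clause;
disjoint from prefix and suffix by the previous remark), so `γ*` is a chord in the target event with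
`|γ*| ≤ |γ[0,s]| + (w₀+1)² + |γ[u,1]|`; the fibre over `γ*` is `{ζ : SAW of Ω_δ from γ(s) to γ(u)}`, of mass
`≤ sup_Ω Z_Ω(t,t') ≤ C(w₀)` for `‖t - t'‖∞ ≤ w₀` — the SPLITTING INDUCTION from the adjacent-pair bubble
(`Z(0,v) ≤ Z(0,v')Z(v',v) + x_c⁻¹ Z(0,v')` for `v' ∼ v` one step closer: split at `v'` or append the edge `v v'`;
chords of `Ω_δ` are chords of a large box, `discreteDomainGraph ≤`); hence
`Z(visits T) ≤ x_c^{-(w₀+1)²} C(w₀) · Z(target)` and chords missing `T` are in the target already: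
`η := (1 + x_c^{-(w₀+1)²} C(w₀))⁻¹`.  WITNESS CHECK: the 1×10 strip and the U-tube of TRIAGE-r2-1/2 are through-rooms
(not behind) resp. fail reconnection inside the box (shafts merge at depth `w₀+3`); F-B's neck-and-room is the instance
`T` = the two top neck sites, `η Z ≤ Z(avoid lower neck ∪ room)`, i.e. (G) is F-B run backwards.
[folklore] -/
def GatedPocketBound (w₀ : ℕ) : Prop :=
  ∃ η : ℝ, 0 < η ∧ ∀ (δ : ℝ) (c a b a' b' : Site 2) (C : (zdGraph 2).Walk c c),
    0 < δ → a' ∈ C.support → b' ∈ C.support → (zdGraph 2).Adj a a' → (zdGraph 2).Adj b b' →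
    ∀ (T : Finset (Site 2)) (q : Site 2), a ∉ T → b ∉ T →
      (∀ t ∈ T, t ∈ meshDomain (dom C δ) δ ∧ InBox q w₀ t) →
      (∀ t ∈ T, ∀ t' ∈ T, ∃ p : (discreteDomainGraph (dom C δ) δ).Walk t t',
        ∀ x ∈ p.support, InBox q w₀ x ∧ (x ∈ T ∨ Behind (dom C δ) δ a b T x)) →
      ENNReal.ofReal η * weight (dom C δ) δ a b Set.univ ≤
        weight (dom C δ) δ a b
          {γ | ∀ v ∈ γ.walk.support, Behind (dom C δ) δ a b T v → InBox q w₀ v}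

/-- **Collar clauses with the collar set `V` explicit** (the body of r8's `IsCollaredOff`, verbatim): `V ⊆ Λ` lies in
the closed annulus `r ≤ |δx − z₀| ≤ R`; `a` is joined to `b` off `V` (the collar is AVOIDABLE); `H` misses the sites
joined to `a` off `V` and misses `V`; some non-domain site lies within `r + δ` of the centre (KS's clause
`∂B(z₀,r) ∩ ∂U_τ ≠ ∅`); and the orientation clauses (edges leaving `V` towards `Near` cross the inner circle, edges
leaving `V` towards sites joined to `H` cross the outer circle — or the other way round).
[folklore] -/
def CollarClauses (Λ : Finset (Site 2)) (a b : Site 2) (δ : ℝ) (z₀ : ℂ) (r R : ℝ)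
    (H V : Finset (Site 2)) : Prop :=
  V ⊆ Λ ∧
    (∀ x ∈ V, r ≤ dist (meshPoint δ x) z₀ ∧ dist (meshPoint δ x) z₀ ≤ R) ∧
    JoinedOff Λ V a b ∧
    (∀ y, JoinedOff Λ V a y → y ∉ H) ∧ (∀ x ∈ V, x ∉ H) ∧
    (∃ p : Site 2, p ∉ Λ ∧ dist (meshPoint δ p) z₀ ≤ r + δ) ∧
    ((∀ x ∈ V, ∀ y ∈ Λ, y ∉ V → (zdGraph 2).Adj x y →
        (JoinedOff Λ V a y → dist (meshPoint δ y) z₀ < r) ∧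
        ((∃ h ∈ H, JoinedOff Λ V y h) → R < dist (meshPoint δ y) z₀)) ∨
     (∀ x ∈ V, ∀ y ∈ Λ, y ∉ V → (zdGraph 2).Adj x y →
        (JoinedOff Λ V a y → R < dist (meshPoint δ y) z₀) ∧
        ((∃ h ∈ H, JoinedOff Λ V y h) → dist (meshPoint δ y) z₀ < r)))

/-- [r8, definitionally] **Collar structure**: some collar set `V` satisfies the collar clauses.
[folklore] -/
def IsCollaredOff (Λ : Finset (Site 2)) (a b : Site 2) (δ : ℝ) (z₀ : ℂ) (r R : ℝ)
    (H : Finset (Site 2)) : Prop :=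
  ∃ V : Finset (Site 2), CollarClauses Λ a b δ z₀ r R H V

/-- **WIDE collar structure at lattice width `w₀`** (the card's regime (D), "doors"): a collar structure whose accesses
are nowhere cut by a lattice box of side `w₀` — for every box `Q` of side `w₀` that TOUCHES the collar set `V` and misses
`a, b`, every site of `H` is still joined to `a` inside `Λ` off `Q`.  Excludes by construction every access of lattice
width `≤ w₀`: the neck-and-room carriers of F-B (width 2), the sheathed necks of BN-4c and the folded rooms of BN5-7 —
the three families through which a uniform pocket bound forces a bubble — and every narrow corridor.
[folklore] -/
def WideCollaredOff (Λ : Finset (Site 2)) (a b : Site 2) (δ : ℝ) (z₀ : ℂ) (r R : ℝ)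
    (H : Finset (Site 2)) (w₀ : ℕ) : Prop :=
  ∃ V : Finset (Site 2), CollarClauses Λ a b δ z₀ r R H V ∧
    ∀ q : Site 2, ¬ InBox q w₀ a → ¬ InBox q w₀ b → (∃ v ∈ V, InBox q w₀ v) →
      ∀ h ∈ H, ∃ p : (zdGraph 2).Walk a h, ∀ x ∈ p.support, x ∈ Λ ∧ ¬ InBox q w₀ x

/-- [r8 verbatim — the ENGINE INTERFACE, registered on the item as the consumer side of `stub_shellIterationCore`]
**SAW collar bound** (the uniform pocket lemma): there are `M > 1`, `η > 0` such that in every r2 domain the critical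
chord avoids every ONE-SIDED set `H` collared off by an annulus of modulus `M` (`δ ≤ r`, `M r ≤ R`) with probability
`≥ η`: `η · Z_Ω(a,b) ≤ Z_{Ω, avoid H}(a,b)`.  Uniform in the domain, the past (any presented slit domain is an r2
domain) and the mesh.  By F-B/BN-4c/BN5-7 it implies a bubble bound of `CriticalBubbleBound` grade — which this line
supplies as STUB 1 instead of hiding.
(HYPOTHESIS NAME of the line — a definition used as a stub hypothesis/conclusion, not a literature fact; status in the
line card.) -/
def SAWCollarBound : Prop :=
  ∃ (M η : ℝ), 1 < M ∧ 0 < η ∧ ∀ (δ : ℝ) (c a b a' b' : Site 2) (C : (zdGraph 2).Walk c c),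
    0 < δ → a' ∈ C.support → b' ∈ C.support → (zdGraph 2).Adj a a' → (zdGraph 2).Adj b b' →
    ∀ (hΛ : (meshDomain (dom C δ) δ).Finite) (z₀ : ℂ) (r R : ℝ) (H : Finset (Site 2)),
      δ ≤ r → M * r ≤ R → IsCollaredOff hΛ.toFinset a b δ z₀ r R H →
      OneSided (lrLE (Ω := dom C δ) (δ := δ) (a := a) (b := b))
        (Avoid (H : Set (Site 2)) : Set (DomainSAW (dom C δ) δ a b)) →
      ENNReal.ofReal η * weight (dom C δ) δ a b Set.univ ≤
        weight (dom C δ) δ a b (Avoid (H : Set (Site 2)))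

/-- **WIDE-DOOR COLLAR BOUND at lattice width `w₀`** (the SEED; the card's `WideDoorG1` in collar form): the SAW collar
bound asserted only for WIDE collar structures (`WideCollaredOff … w₀`).  This is the scale-free RSW regime where PA is
meant to work (round-1 seeds: canonical door numbers DoorSquare 1.540/1.531 at n = 2, 3, two-stump door, carve / fill /
sandwich reductions `stub_carveCore` p85301); no bubble obstruction of the F-B type can be built inside the class.
[folklore] -/
def WideCollarBound (w₀ : ℕ) : Prop :=
  ∃ (M η : ℝ), 1 < M ∧ 0 < η ∧ ∀ (δ : ℝ) (c a b a' b' : Site 2) (C : (zdGraph 2).Walk c c),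
    0 < δ → a' ∈ C.support → b' ∈ C.support → (zdGraph 2).Adj a a' → (zdGraph 2).Adj b b' →
    ∀ (hΛ : (meshDomain (dom C δ) δ).Finite) (z₀ : ℂ) (r R : ℝ) (H : Finset (Site 2)),
      δ ≤ r → M * r ≤ R → WideCollaredOff hΛ.toFinset a b δ z₀ r R H w₀ →
      OneSided (lrLE (Ω := dom C δ) (δ := δ) (a := a) (b := b))
        (Avoid (H : Set (Site 2)) : Set (DomainSAW (dom C δ) δ a b)) →
      ENNReal.ofReal η * weight (dom C δ) δ a b Set.univ ≤
        weight (dom C δ) δ a b (Avoid (H : Set (Site 2)))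

/-- [r8 verbatim] **Per-shell tightness of the traversal counts** for the shells of modulus `≥ M`.
[folklore] -/
def ShellTight (M : ℝ) (D : DobrushinDomain) (a b : ℝ → Site 2) : Prop :=
  ∃ δ₀ : ℝ, 0 < δ₀ ∧ ∀ (x : ℂ) (ρ R : ℝ), 0 < ρ → M * ρ ≤ R → R ≤ 1 → ∀ ε : ℝ, 0 < ε → ∃ n : ℕ,
    ∀ δ ∈ Set.Ioc (0 : ℝ) δ₀, δ ≤ ρ →
      law D.carrier δ (a δ) (b δ)
          {γ | (⟨γ.walk.toCurve (meshPoint δ)⟩ : Curve ℂ).HasTraversals n x ρ R} ≤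
        ENNReal.ofReal ε

/-- [r8 verbatim] **Per-shell tightness on a class of MESHES** (`P δ`).
[folklore] -/
def ShellTightOn (P : ℝ → Prop) (M : ℝ) (D : DobrushinDomain) (a b : ℝ → Site 2) : Prop :=
  ∃ δ₀ : ℝ, 0 < δ₀ ∧ ∀ (x : ℂ) (ρ R : ℝ), 0 < ρ → M * ρ ≤ R → R ≤ 1 → ∀ ε : ℝ, 0 < ε → ∃ n : ℕ,
    ∀ δ ∈ Set.Ioc (0 : ℝ) δ₀, δ ≤ ρ → P δ →
      law D.carrier δ (a δ) (b δ)
          {γ | (⟨γ.walk.toCurve (meshPoint δ)⟩ : Curve ℂ).HasTraversals n x ρ R} ≤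
        ENNReal.ofReal ε

/-- [r8 verbatim; its body is the `Presentable` of `Negative.deepStart_not_presentable`] The lattice domain `D_δ` with
endpoints `u, v` is **presentable** as an instance of `LeftRightFKG`.
[folklore] -/
def Presentable (D : DobrushinDomain) (δ : ℝ) (u v : Site 2) : Prop :=
  ∃ (c u' v' : Site 2) (C : (zdGraph 2).Walk c c), u' ∈ C.support ∧ v' ∈ C.support ∧
    (zdGraph 2).Adj u u' ∧ (zdGraph 2).Adj v v' ∧
    discreteDomainGraph D.carrier δ = discreteDomainGraph (dom C δ) δ

/-- [r8 verbatim] Output of the iteration: per-shell tightness at some modulus `M > 1`, for every endpoint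
approximation, AT THE PRESENTABLE MESHES.  SCOPE FINDING of this planner (S-1, sharpening Disproof F3(c)): r2 graphs
are INDUCED, so a mesh at which `D_δ = discreteDomainGraph D.carrier δ` drops a lattice edge between two of its sites
(`¬ InducedMesh`) is never presentable — and this happens for a COFINAL set of meshes (generic position of the tip
relative to `δℤ²`) as soon as `∂D` has a re-entrant exterior wedge crossed transversally by a lattice direction:
always when its opening is `< π/2` (interior angle `> 3π/2`: any slit-like bay), orientation-dependent for openings in
`[π/2, π)`, never for the axis-parallel L-corner — so not only for oscillating prime ends; for such `D` this statement is
silent at those meshes and `DeepShellTight` carries them.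
(HYPOTHESIS NAME of the line — a definition used as a stub hypothesis/conclusion, not a literature fact; status in the
line card.) -/
def GoodShellTight : Prop :=
  ∃ M : ℝ, 1 < M ∧ ∀ (D : DobrushinDomain) (a b : ℝ → Site 2),
    IsEndpointApprox D a b → ShellTightOn (fun δ => Presentable D δ (a δ) (b δ)) M D a b

/-- The lattice domain `D_δ` is an INDUCED subgraph of `ℤ²` on its vertex set: no lattice edge between two sites of
`meshDomain` is dropped (the Chelkak–Hongler–Izyurov convention `[δx, δy] ⊆ Ω̄` drops an edge when a thin exterior fjord
passes between two interior mesh points — near the tip of any sharp re-entrant exterior wedge, at every scale).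
[folklore] -/
def InducedMesh (D : DobrushinDomain) (δ : ℝ) : Prop :=
  ∀ x ∈ meshDomain D.carrier δ, ∀ y ∈ meshDomain D.carrier δ,
    (zdGraph 2).Adj x y → (discreteDomainGraph D.carrier δ).Adj x y

/-- **Deep-fragment per-shell tightness** (the (α) conjunct of `crux_iff_split` in the line's currency): per-shell
tightness at SOME modulus `M > 1`, for every endpoint approximation, AT THE NON-PRESENTABLE MESHES — (i) deep
endpoints on induced meshes (`deepStart_eventually_not_presentable`: non-presentable at every small mesh, so no `δ₀`
makes this vacuous) — the slit necklace's territory, `DeepShellTightInduced`; and (ii) NON-INDUCED meshes (S-1 above,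
`RoughMeshShellTight`), where no piece of the chord lives on an r2 graph and the intended treatment is comparison with
the INDUCED COMPANION law by local finite energy at the blocked edges (boundedly many per corner for tame `D`; OPEN for
wild Jordan boundaries).  r8's `ResidualShellTight` asked all of it for EVERY `M > 1`; the glue only needs one modulus
(`shellTightOn_mono`, `max`), and `deepShellTight_of_split` certifies the split (i) + (ii) ⇒ this for a later glued
split of STUB 6.
(HYPOTHESIS NAME of the line — a definition used as a stub hypothesis/conclusion, not a literature fact; status in the
line card.) -/
def DeepShellTight : Prop :=
  ∃ M : ℝ, 1 < M ∧ ∀ (D : DobrushinDomain) (a b : ℝ → Site 2),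
    IsEndpointApprox D a b → ShellTightOn (fun δ => ¬ Presentable D δ (a δ) (b δ)) M D a b

/-- (i) of `DeepShellTight`: the non-presentable INDUCED meshes (deep endpoints proper).
(HYPOTHESIS NAME of the line — a definition used as a stub hypothesis/conclusion, not a literature fact; status in the
line card.) -/
def DeepShellTightInduced : Prop :=
  ∃ M : ℝ, 1 < M ∧ ∀ (D : DobrushinDomain) (a b : ℝ → Site 2),
    IsEndpointApprox D a b →
      ShellTightOn (fun δ => ¬ Presentable D δ (a δ) (b δ) ∧ InducedMesh D δ) M D a b

/-- (ii) of `DeepShellTight`: the NON-INDUCED meshes (rough discretisations; Disproof F3(c) sharpened to S-1).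
(HYPOTHESIS NAME of the line — a definition used as a stub hypothesis/conclusion, not a literature fact; status in the
line card.) -/
def RoughMeshShellTight : Prop :=
  ∃ M : ℝ, 1 < M ∧ ∀ (D : DobrushinDomain) (a b : ℝ → Site 2),
    IsEndpointApprox D a b → ShellTightOn (fun δ => ¬ InducedMesh D δ) M D a b

/-- **GERM EXCURSION MEAN** (the rate-free residue of the deep conjunct; triage r2-2 sharpen (2) ≡ BN5-6 `DeepNoReturn`
kernel in first-moment form).  For every endpoint approximation there are `M̄`, `C₀ > 11/10`, `δ₀ > 0` such that for
`δ ≤ δ₀` the EXPECTED NUMBER of separate traversals by the chord of the crossover annulus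
`D(a_δ; 1.1 d, C₀ d)`, `d = d(δ) := dist(δ·a_δ, ∂D)` (inner radius just outside the depth ball, SHRINKING with `δ`), is
at most `M̄` — and the same at `b`.  (`E[N] = Σ_{k ≥ 1} P(N ≥ k)`, `HasTraversals` is monotone in `k`.)  For boundary
approximations `d ≍ δ` and the count is deterministically bounded (`k ≤ 2|γ ∩ annulus|`), so the statement has content
exactly on the deep fragment; conjecturally true with geometric tails (interior returns of SLE_{8/3} to a fixed-ratio
annulus about its starting region); numerically testable (ideator-4 `necklace.py` regime); shared with every tightness
route; its natural quenched proof would condition on a floating past (F7 / triage X1, j011295) — which is why it is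
filed as an INPUT and not hidden in STUB 6.
(HYPOTHESIS NAME of the line — a definition used as a stub hypothesis/conclusion, not a literature fact; status in the
line card.) -/
def GermExcursionMean : Prop :=
  ∀ (D : DobrushinDomain) (a b : ℝ → Site 2), IsEndpointApprox D a b →
    ∃ (Mbar C₀ δ₀ : ℝ), 11 / 10 < C₀ ∧ 0 < δ₀ ∧ ∀ δ ∈ Set.Ioc (0 : ℝ) δ₀,
      (∑' k : ℕ, law D.carrier δ (a δ) (b δ)
          {γ | (⟨γ.walk.toCurve (meshPoint δ)⟩ : Curve ℂ).HasTraversals (k + 1) (meshPoint δ (a δ))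
            (11 / 10 * infDist (meshPoint δ (a δ)) D.carrierᶜ) (C₀ * infDist (meshPoint δ (a δ)) D.carrierᶜ)})
        ≤ ENNReal.ofReal Mbar ∧
      (∑' k : ℕ, law D.carrier δ (a δ) (b δ)
          {γ | (⟨γ.walk.toCurve (meshPoint δ)⟩ : Curve ℂ).HasTraversals (k + 1) (meshPoint δ (b δ))
            (11 / 10 * infDist (meshPoint δ (b δ)) D.carrierᶜ) (C₀ * infDist (meshPoint δ (b δ)) D.carrierᶜ)})
        ≤ ENNReal.ofReal Mbar


/-! ## Basic closed glue lemmas (moduli by `max`, mesh classes by cover; used by the composition and by STUB 6) -/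

/-- Per-shell tightness on a mesh class is MONOTONE in the modulus: a larger `M` asks for fewer shells. -/
theorem shellTightOn_mono {P : ℝ → Prop} {M M' : ℝ} {D : DobrushinDomain} {a b : ℝ → Site 2}
    (hMM' : M ≤ M') (h : ShellTightOn P M D a b) : ShellTightOn P M' D a b := by
  obtain ⟨δ₀, hδ₀, H⟩ := h
  refine ⟨δ₀, hδ₀, fun x ρ R hρ hMR hR1 ε hε => ?_⟩
  exact H x ρ R hρ (le_trans (mul_le_mul_of_nonneg_right hMM' hρ.le) hMR) hR1 ε hε

/-- [r8] **Mesh-wise glue**: per-shell tightness on a class of meshes and on its complement give per-shell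
tightness (`δ₀ := min`, `n := max`, `HasTraversals.of_le`). -/
theorem shellTight_of_on {P : ℝ → Prop} {M : ℝ} {D : DobrushinDomain} {a b : ℝ → Site 2}
    (h₁ : ShellTightOn P M D a b) (h₂ : ShellTightOn (fun δ => ¬ P δ) M D a b) : ShellTight M D a b := by
  classical
  obtain ⟨δ₁, hδ₁, H₁⟩ := h₁
  obtain ⟨δ₂, hδ₂, H₂⟩ := h₂
  refine ⟨min δ₁ δ₂, lt_min hδ₁ hδ₂, ?_⟩
  intro x ρ R hρ hMR hR1 ε hε
  obtain ⟨n₁, hn₁⟩ := H₁ x ρ R hρ hMR hR1 ε hε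
  obtain ⟨n₂, hn₂⟩ := H₂ x ρ R hρ hMR hR1 ε hε
  refine ⟨max n₁ n₂, ?_⟩
  intro δ hδ hδρ
  have hδ1 : δ ∈ Set.Ioc (0 : ℝ) δ₁ := ⟨hδ.1, hδ.2.trans (min_le_left _ _)⟩
  have hδ2 : δ ∈ Set.Ioc (0 : ℝ) δ₂ := ⟨hδ.1, hδ.2.trans (min_le_right _ _)⟩
  by_cases hP : P δ
  · refine le_trans (measure_mono ?_) (hn₁ δ hδ1 hδρ hP)
    intro γ hγ
    exact Curve.HasTraversals.of_le hγ (le_max_left _ _)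
  · refine le_trans (measure_mono ?_) (hn₂ δ hδ2 hδρ hP)
    intro γ hγ
    exact Curve.HasTraversals.of_le hγ (le_max_right _ _)

/-- **Cover glue**: per-shell tightness on two mesh classes gives it on any class they cover
(`δ₀ := min`, `n := max`, `HasTraversals.of_le`). -/
theorem shellTightOn_of_cover {P P₁ P₂ : ℝ → Prop} {M : ℝ} {D : DobrushinDomain} {a b : ℝ → Site 2}
    (h₁ : ShellTightOn P₁ M D a b) (h₂ : ShellTightOn P₂ M D a b) (hcov : ∀ δ, P δ → P₁ δ ∨ P₂ δ) :
    ShellTightOn P M D a b := by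
  classical
  obtain ⟨δ₁, hδ₁, H₁⟩ := h₁
  obtain ⟨δ₂, hδ₂, H₂⟩ := h₂
  refine ⟨min δ₁ δ₂, lt_min hδ₁ hδ₂, ?_⟩
  intro x ρ R hρ hMR hR1 ε hε
  obtain ⟨n₁, hn₁⟩ := H₁ x ρ R hρ hMR hR1 ε hε
  obtain ⟨n₂, hn₂⟩ := H₂ x ρ R hρ hMR hR1 ε hε
  refine ⟨max n₁ n₂, ?_⟩
  intro δ hδ hδρ hP
  have hδ1 : δ ∈ Set.Ioc (0 : ℝ) δ₁ := ⟨hδ.1, hδ.2.trans (min_le_left _ _)⟩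
  have hδ2 : δ ∈ Set.Ioc (0 : ℝ) δ₂ := ⟨hδ.1, hδ.2.trans (min_le_right _ _)⟩
  rcases hcov δ hP with hP₁ | hP₂
  · refine le_trans (measure_mono ?_) (hn₁ δ hδ1 hδρ hP₁)
    intro γ hγ
    exact Curve.HasTraversals.of_le hγ (le_max_left _ _)
  · refine le_trans (measure_mono ?_) (hn₂ δ hδ2 hδρ hP₂)
    intro γ hγ
    exact Curve.HasTraversals.of_le hγ (le_max_right _ _)

/-- **Pre-certified glued split of STUB 6** (scope finding S-1): the necklace part (non-presentable INDUCED meshes) and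
the rough-mesh part (NON-INDUCED meshes) together give `DeepShellTight` (moduli by `max`, classes by cover). -/
theorem deepShellTight_of_split : DeepShellTightInduced → RoughMeshShellTight → DeepShellTight := by
  intro h₁ h₂
  obtain ⟨M₁, hM₁, H₁⟩ := h₁
  obtain ⟨M₂, -, H₂⟩ := h₂
  refine ⟨max M₁ M₂, lt_max_of_lt_left hM₁, fun D a b hab => ?_⟩
  refine shellTightOn_of_cover (shellTightOn_mono (le_max_left _ _) (H₁ D a b hab))
    (shellTightOn_mono (le_max_right _ _) (H₂ D a b hab)) fun δ hP => ?_
  by_cases hI : InducedMesh D δ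
  · exact Or.inl ⟨hP, hI⟩
  · exact Or.inr hI


end Summit.CriticalPhenomena.SAWScalingLimit.Theorems.FKGToTraversalBound.GatesByBubbleDoorsByFKG

end
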